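import Summits.ResolutionOfSingularities.ResolutionOfSingularities.Theses.RisoStrata
import Literature.AlgebraicGeometry.Resolution.NonReducedNoResolution

/-!
# Disproof of `RisoGlobalisation` (crux stmt-ResolutionOfSingularities-18547, route RisoStrata) — findings

Standing disprover's work file (cdisprove, cycle 1, 2026-08-17).  Prose only in docstrings.

The crux is the GLUE statement
`RisoGlobalisation = ∀ p prime, H1 p → H2 p → Concl p` (`risoGlobalisation_iff`, by `Iff.rfl`) with
* `H1 p` = body of the sibling crux `RtdLocal` at `p` (Zariski-locality of the typed rtd),
* `H2 p` = body of the sibling crux `RisoCentresResolve` at `p` (∃ schedule, valuative towers regular),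
* `Concl p` = resolution of every INTEGRAL separated finite-type scheme over every algebraically
  closed field of characteristic `p` (`Scheme.HasResolution`).

## Verdict of cycle 1: NO KILL — and why it resists (kernel-checked where marked ✓)

1. ✓ `concl_of_resolutionInChar`, `not_resolution_of_not_risoGlobalisation`: the conclusion block is
   a special case of the summit conjunct, so `¬ RisoGlobalisation → ¬ ResolutionOfSingularities`.
   An unconditional disproof of this crux IS a counterexample to resolution of singularities in some
   prime characteristic (✓ `exists_counterexample_of_not_risoGlobalisation`: it must exhibit a prime
   at which `H1`, `H2` hold and `Concl` fails).  No such object is in reach; compute falsifiers n/a.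
2. Vacuity (would make the crux TRIVIALLY TRUE, ✓ `risoGlobalisation_of_forall_not_H2/H1`):
   * `H1` is believed PROVABLE (both directions of the rtd transport sketched in §5 docstrings:
     `⇐` by the graph straightener `φ' = (φ, ℓ ∘ φ)`, `⇒` by the linear part `N = dP(0)` of the
     re-presentation, injective on `W' ⊆` tangent cone) — so no vacuity from `H1`.
   * `H2` is the open sibling crux (Monreal Q1.6 in char `p`); every DEGENERATE presentation probed
     for cheap falsity comes out true (K = k; ℙ¹; cusp `h = (1,t²,t³)`; trivial valuation ring
     `O = K` where `loc` is the fraction field; `Cen = ⊤` stages = localisations; `Cen ≠ ⊥` always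
     since `Sing` is a proper closed subset of a variety over a perfect field; O-minimal elements
     exist because `Cen` is finitely generated) and the "unreachable singular point" attack fails
     (typed `Rtd B m r ⇒ r ≤ dim B`: `W ⊆` leading vectors of arcs at the constant arc `⊆ C_m(Spec B)`),
     see §5.  These confirm and cite the earlier seat refuter-rattack-18547 (item note 05:03Z).
3. Load-bearing analysis.  RELATIVE (✓ §3): dropping `H2` turns the crux into the algebraically
   closed integral case of the summit outright (`withoutH2_iff_concl`); dropping `H1` leaves the
   chart-to-chart gluing of the rtd-cuts unjustified (prose; no `¬` provable — it would again be a
   counterexample to resolution).  ABSOLUTE (✓ §4): inside the conclusion block, `IsIntegral X`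
   cannot be dropped (`concl_false_without_isIntegral`, witness `Spec 𝔽̄_p[ε]`, via the tree lemma
   `not_hasResolution_spec_dualNumber`) — `Scheme.HasResolution` admits no junk witness on a
   generically non-reduced scheme; weakening `IsIntegral` to `IsReduced` is NOT refutable (it is the
   summit's own hypothesis; reducible ⇒ components by the proved `ComponentGluing`).
4. Glue modelling (the planner's why-might-fail) checks out on paper (§5): `step B d x = B[Cen/x]`
   is the `x`-chart of `Bl_Cen`, the centre of `O` lies in that chart iff `x` is `O`-minimal
   (= `Valid`), `loc O B = B_(𝔪_O ∩ B)` for `B ⊆ O`, `Cen(B,d) = I(closure of the cut)` is radical in a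
   Jacobson ring and localises correctly GIVEN `H1`; every point of the iterated blow-up is the
   centre of some `O ⊇ B^{(j)}`.  The ideators' cards (blowup-tower-rees-charts, segre-representation,
   graph-closure-vector, vanishing-ideal-blowup-tower) name proved tree API for Chow / blow-ups /
   projective models; nothing found that a disprover can break.

## Index
* §1 packaging (`H1`, `H2`, `Concl`, `risoGlobalisation_iff`, links to `RtdLocal`/`RisoCentresResolve`)
* §2 why it resists (summit ⇒ crux; ¬crux ⇒ ¬summit; shape of any counterexample)
* §3 load-bearing, relative (`WithoutH1`, `WithoutH2`, vacuity directions)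
* §4 load-bearing, absolute: conclusion-block hypotheses (`concl_false_without_isIntegral` ✓)
* §5 attempts / near-misses / encoding analysis (docstrings on `True`-valued markers; no `sorry`)
-/

noncomputable section

-- single-problem summit: the doubled namespace component `ResolutionOfSingularities` is forced
set_option linter.dupNamespace false

namespace Summit.ResolutionOfSingularities.ResolutionOfSingularities.Cruxes.RisoGlobalisation.Disproof

open Summit.ResolutionOfSingularities.ResolutionOfSingularities.Theses.RisoStrata
open CategoryTheory AlgebraicGeometry
open Literature.AlgebraicGeometry.Resolution

/-! ## §1 Packaging: the crux is `∀ p prime, H1 p → H2 p → Concl p` -/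

/-- `H1 p`: the body of the sibling crux `RtdLocal` (stmt-18840) at the prime `p` — Zariski-locality
of the typed riso-triviality dimension under one adjoined inverse. [folklore] -/
def H1 (p : ℕ) : Prop :=
  ∀ (k : Type) [Field k] [CharP k p] [IsAlgClosed k] (K : Type) [Field K] [Algebra k K] (B : Subalgebra k K) (s : K) (hs : s ∈ B), s ≠ 0 → B.FG → let Arc : ∀ (B : Subalgebra k K), Ideal ↥B → Type := fun B m => {α : ↥B →ₐ[k] HahnSeries ℚ k // ∀ b ∈ m, 0 < (α b).orderTop}; let Rtd : ∀ (B : Subalgebra k K), Ideal ↥B → ℕ → Prop := fun B m r => ∃ (n : ℕ) (g : Fin n → ↥B), (∀ i, g i ∈ m) ∧ Algebra.adjoin k (Set.range fun i => (g i : K)) = B ∧ ∃ W : Submodule k (Fin n → k), r ≤ Module.finrank k ↥W ∧ ∃ φ : Arc B m → (Fin n → HahnSeries ℚ k), (∀ a b : Arc B m, a ≠ b → ∃ j, ∀ i, (a.1 (g j) - b.1 (g j)).orderTop < ((φ a i - φ b i) - (a.1 (g i) - b.1 (g i))).orderTop) ∧ (∀ a i, 0 < (φ a i).orderTop) ∧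 (∀ a, ∀ w : Fin n → HahnSeries ℚ k, (∀ i, 0 < (w i).orderTop) → w ∈ Submodule.span (HahnSeries ℚ k) ((fun u : Fin n → k => fun i => HahnSeries.C (u i)) '' (W : Set (Fin n → k))) → ∃ b, φ b = φ a + w); ∀ (m' : Ideal ↥(Algebra.adjoin k ((B : Set K) ∪ {s⁻¹}))), m'.IsMaximal → ∀ r : ℕ, (Rtd (Algebra.adjoin k ((B : Set K) ∪ {s⁻¹})) m' r ↔ Rtd B (m'.comap (Subalgebra.inclusion (show B ≤ Algebra.adjoin k ((B : Set K) ∪ {s⁻¹}) from fun _ hb => Algebra.subset_adjoin (Set.mem_union_left _ hb)))) r)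

/-- `H2 p`: the body of the sibling crux `RisoCentresResolve` (stmt-18546) at the prime `p` — one
finite schedule of rtd-cut centres makes every valuative tower end in a regular local ring. [folklore] -/
def H2 (p : ℕ) : Prop :=
  ∀ (k : Type) [Field k] [CharP k p] [IsAlgClosed k] (K : Type) [Field K] [Algebra k K] (N : ℕ) (h : Fin (N + 1) → K), (∀ i, h i ≠ 0) → IntermediateField.adjoin k (Set.range fun ij : Fin (N + 1) × Fin (N + 1) => h ij.1 * (h ij.2)⁻¹) = ⊤ → let Arc : ∀ (B : Subalgebra k K), Ideal ↥B → Type := fun B m => {α : ↥B →ₐ[k] HahnSeries ℚ k // ∀ b ∈ m, 0 < (α b).orderTop}; let Rtd : ∀ (B : Subalgebra k K), Ideal ↥B → ℕ → Prop := fun B m r => ∃ (n : ℕ) (g : Fin n → ↥B), (∀ i, g i ∈ m) ∧ Algebra.adjoin k (Set.range fun i => (g i : K)) = B ∧ ∃ W : Submodule k (Fin n → k), r ≤ Module.finrank k ↥W ∧ ∃ φ : Arc B m → (Fin n → HahnSeries ℚ k), (∀ a b : Arc B m, a ≠ b → ∃ j, ∀ i, (a.1 (g j) - b.1 (g j)).orderTop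 < ((φ a i - φ b i) - (a.1 (g i) - b.1 (g i))).orderTop) ∧ (∀ a i, 0 < (φ a i).orderTop) ∧ (∀ a, ∀ w : Fin n → HahnSeries ℚ k, (∀ i, 0 < (w i).orderTop) → w ∈ Submodule.span (HahnSeries ℚ k) ((fun u : Fin n → k => fun i => HahnSeries.C (u i)) '' (W : Set (Fin n → k))) → ∃ b, φ b = φ a + w); let Cen : ∀ (B : Subalgebra k K), ℕ → Ideal ↥B := fun B d => ⨅ m ∈ {m : Ideal ↥B | ∃ hm : m.IsMaximal, ¬ IsRegularLocalRing (Localization (@Ideal.primeCompl ↥B _ m hm.isPrime)) ∧ ¬ Rtd B m (d + 1)}, m; let step : Subalgebra k K → ℕ → K → Subalgebra k K := fun B d xt => Algebra.adjoin k ((B : Set K) ∪ {y | ∃ a ∈ Cen B d, y = (a : K) * xt⁻¹}); let Valid : ValuationSubring K → Subalgebra k K → ℕ → K → Prop := fun O B d xt => xt ≠ 0 ∧ (∃ x ∈ Cen B d, (x : K) = xt) ∧ ∀ a' ∈ Cen B d, (a' : K) * xt⁻¹ ∈ O; let stage : Subalgebra k K → List ℕ → (ℕ → K) → ℕ → Subalgebra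 k K := fun B₀ sched x t => ((sched.take t).zipIdx).foldl (fun B de => step B de.1 (x de.2)) B₀; let loc : ValuationSubring K → Subalgebra k K → Subalgebra k K := fun O B => Algebra.adjoin k {y | ∃ a ∈ B, ∃ s ∈ B, s⁻¹ ∈ O ∧ y = a * s⁻¹}; ∃ sched : List ℕ, ∀ O : ValuationSubring K, (∀ c : k, algebraMap k K c ∈ O) → ∀ j : Fin (N + 1), (∀ i, h i * (h j)⁻¹ ∈ O) → ∀ x : ℕ → K, (∀ t, t < sched.length → Valid O (stage (Algebra.adjoin k (Set.range fun i => h i * (h j)⁻¹)) sched x t) (sched.getD t 0) (x t)) → IsRegularLocalRing ↥(loc O (stage (Algebra.adjoin k (Set.range fun i => h i * (h j)⁻¹)) sched x sched.length))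

/-- `Concl p`: the conclusion block of the crux — resolution of integral separated finite-type
schemes over algebraically closed fields of characteristic `p`. [folklore] -/
def Concl (p : ℕ) : Prop :=
  ∀ (k : Type) [Field k] [CharP k p] [IsAlgClosed k] (X : Scheme.{0}) (f : X ⟶ Spec (.of k)),
    IsSeparated f → LocallyOfFiniteType f → QuasiCompact f → IsIntegral X → Scheme.HasResolution X

/-- The crux, unfolded: `RisoGlobalisation` is literally `∀ p prime, H1 p → H2 p → Concl p`. [folklore] -/
theorem risoGlobalisation_iff :
    RisoGlobalisation ↔ ∀ p : ℕ, p.Prime → H1 p → H2 p → Concl p :=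
  Iff.rfl

/-- `H1` is the body of the sibling route item `RtdLocal`. [folklore] -/
theorem rtdLocal_iff : RtdLocal ↔ ∀ p : ℕ, p.Prime → H1 p := Iff.rfl

/-- `H2` is the body of the sibling route item `RisoCentresResolve`. [folklore] -/
theorem risoCentresResolve_iff : RisoCentresResolve ↔ ∀ p : ℕ, p.Prime → H2 p := Iff.rfl

/-! ## §2 Why it resists: the conclusion block is a special case of the summit -/

/-- `ResolutionInChar p` (all fields of char `p`, reduced schemes) implies the crux's conclusion
block (algebraically closed fields, integral schemes). [folklore] -/
theorem concl_of_resolutionInChar {p : ℕ} (h : ResolutionInChar.{0} p) : Concl p := by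
  intro k _ _ _ X f hsep hlft hqc hint
  exact h k X f hsep hlft hqc inferInstance

/-- The summit implies the crux with both hypotheses unused (C ≤ S, as for every glue crux;
first recorded by refuter-rattack-18547, Probes.lean). [folklore] -/
theorem risoGlobalisation_of_resolution (h : _root_.ResolutionOfSingularities) : RisoGlobalisation :=
  fun p hp _ _ => concl_of_resolutionInChar (_root_.ResolutionOfSingularities_iff.mp h p hp)

/-- WHY IT RESISTS: an unconditional disproof of the crux disproves resolution of singularities in
positive characteristic. [folklore] -/
theorem not_resolution_of_not_risoGlobalisation (h : ¬ RisoGlobalisation) :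
    ¬ _root_.ResolutionOfSingularities :=
  fun hS => h (risoGlobalisation_of_resolution hS)

/-- Shape of any counterexample: a prime at which BOTH hypotheses hold (in particular the open
sibling crux `H2 p`) and resolution fails for some integral variety over an algebraically closed
field. [folklore] -/
theorem exists_counterexample_of_not_risoGlobalisation (h : ¬ RisoGlobalisation) :
    ∃ p : ℕ, p.Prime ∧ H1 p ∧ H2 p ∧ ¬ Concl p := by
  by_contra hc
  exact h fun p hp h1 h2 => by_contra fun hC => hc ⟨p, hp, h1, h2, hC⟩

/-! ## §3 Load-bearing analysis, relative form

`¬ WithoutH2` / `¬ WithoutH1` are NOT provable (each would again be a counterexample to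
resolution); what is provable is what dropping a hypothesis COSTS. -/

/-- The crux with `H2` (the schedule) dropped. [folklore] -/
def WithoutH2 : Prop := ∀ p : ℕ, p.Prime → H1 p → Concl p

/-- The crux with `H1` (rtd locality) dropped. [folklore] -/
def WithoutH1 : Prop := ∀ p : ℕ, p.Prime → H2 p → Concl p

/-- Either weakening implies the crux. [folklore] -/
theorem risoGlobalisation_of_withoutH2 (h : WithoutH2) : RisoGlobalisation :=
  fun p hp h1 _ => h p hp h1

/-- Either weakening implies the crux. [folklore] -/
theorem risoGlobalisation_of_withoutH1 (h : WithoutH1) : RisoGlobalisation :=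
  fun p hp _ h2 => h p hp h2

/-- `H2` IS LOAD-BEARING (relative form): granted `H1` (believed provable, §5), proving the crux
without `H2` is proving the algebraically-closed integral case of the summit outright. [folklore] -/
theorem withoutH2_iff_concl (hH1 : ∀ p : ℕ, p.Prime → H1 p) :
    WithoutH2 ↔ ∀ p : ℕ, p.Prime → Concl p :=
  ⟨fun h p hp => h p hp (hH1 p hp), fun h p hp _ => h p hp⟩

/-- Vacuity direction 1: if the schedule crux failed at every prime, the glue would be trivially
true (and the route dead through stmt-18546, not through this item). [folklore] -/
theorem risoGlobalisation_of_forall_not_H2 (h : ∀ p : ℕ, p.Prime → ¬ H2 p) : RisoGlobalisation :=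
  fun p hp _ h2 => (h p hp h2).elim

/-- Vacuity direction 2: same for `H1`. [folklore] -/
theorem risoGlobalisation_of_forall_not_H1 (h : ∀ p : ℕ, p.Prime → ¬ H1 p) : RisoGlobalisation :=
  fun p hp h1 _ => (h p hp h1).elim

/-- Pointwise vacuity: at a single prime. [folklore] -/
theorem imp_of_not_H2 {p : ℕ} (h : ¬ H2 p) : H1 p → H2 p → Concl p :=
  fun _ h2 => (h h2).elim

/-! ## §4 Load-bearing analysis, absolute form: hypotheses of the conclusion block -/

/-- `Concl p` with `IsIntegral X` dropped (nothing in its place). [folklore] -/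
def ConclWithoutIsIntegral (p : ℕ) : Prop :=
  ∀ (k : Type) [Field k] [CharP k p] [IsAlgClosed k] (X : Scheme.{0}) (f : X ⟶ Spec (.of k)),
    IsSeparated f → LocallyOfFiniteType f → QuasiCompact f → Scheme.HasResolution X

/-- ✓ `IsIntegral X` IS LOAD-BEARING in the conclusion block: over `k = 𝔽̄_p` the one-point
non-reduced scheme `Spec k[ε]` (affine, of finite type) has no resolution — a dense open of a point
is everything and `π` would restrict to an isomorphism from a reduced scheme (tree:
`not_hasResolution_spec_dualNumber`).  `Scheme.HasResolution` has no junk inhabitant there.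
(Weakening `IsIntegral` to `IsReduced` is the summit's hypothesis and is not refutable.) [folklore] -/
theorem concl_false_without_isIntegral (p : ℕ) [Fact p.Prime] : ¬ ConclWithoutIsIntegral p := by
  intro h
  haveI : Module.Finite (AlgebraicClosure (ZMod p)) (DualNumber (AlgebraicClosure (ZMod p))) :=
    inferInstanceAs (Module.Finite (AlgebraicClosure (ZMod p))
      (AlgebraicClosure (ZMod p) × AlgebraicClosure (ZMod p)))
  let f : Spec (.of (DualNumber (AlgebraicClosure (ZMod p)))) ⟶ Spec (.of (AlgebraicClosure (ZMod p))) :=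
    Spec.map (CommRingCat.ofHom (algebraMap (AlgebraicClosure (ZMod p))
      (DualNumber (AlgebraicClosure (ZMod p)))))
  haveI : LocallyOfFiniteType f :=
    (HasRingHomProperty.Spec_iff (P := @LocallyOfFiniteType)).mpr
      (RingHom.finiteType_algebraMap.mpr inferInstance)
  exact not_hasResolution_spec_dualNumber (AlgebraicClosure (ZMod p))
    (h (AlgebraicClosure (ZMod p)) (Spec (.of (DualNumber (AlgebraicClosure (ZMod p))))) f
      inferInstance inferInstance inferInstance)

/-- Hence the crux with `IsIntegral X` deleted from its conclusion block is refutable as soon as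
its two hypotheses hold at one prime; stated in the usable contrapositive-free form. [folklore] -/
theorem not_imp_conclWithoutIsIntegral {p : ℕ} [Fact p.Prime] (h1 : H1 p) (h2 : H2 p) :
    ¬ (H1 p → H2 p → ConclWithoutIsIntegral p) :=
  fun h => concl_false_without_isIntegral p (h h1 h2)

/-! ## §5 Attempts, near-misses, encoding analysis (prose; markers are `True`)

Each marker records one attack of cycle 1 and why it did not kill the crux. -/

/-- ATTACK A (restates-summit / circularity).  `Concl p` ≤ summit (§2).  Converse only through
`closes` with `H1 = RtdLocal@p`, `H2 = RisoCentresResolve@p`; `H2` is not the summit in disguise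
(resolution ⇏ a memoryless rtd-cut schedule; open even in char 0, Monreal arXiv:2606.12554 Q1.6).
No circularity, no kill. [folklore] -/
theorem attackA_restatesSummit : True := trivial

/-- ATTACK B (vacuity of `H2` by encoding junk) — all probes TRUE, no kill:
* `K = k` (`N = 0`, `h 0 = 1`): only `O = ⊤`; `B₀ = ⊥`; field `k` has no singular maximal ideal so
  `Cen = ⊤`; `sched = []`; `loc ⊤ ⊥ = ⊥ ≅ k`, a field, regular.
* trivial valuation ring `O = ⊤ = K` for any `K`: `Valid` = any nonzero `x_t ∈ Cen`; `loc ⊤ B` is the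
  fraction field of `B` inside `K` (all `a·s⁻¹`), a field ⇒ regular.  No constraint, no junk.
* `Cen B d = ⊤` (no singular point of rtd `≤ d` on this chart): `Valid` forces `x_t ∈ B ∩ O×`, and
  `step = B[x_t⁻¹] ⊆ B_(𝔪_O∩B)`, so `loc` is unchanged — consistent with `Bl_⊤ = id` globally.
* `Cen B d = ⊥` would make `Valid` unsatisfiable (x_t ≠ 0 ∧ x_t ∈ ⊥) and `H2` vacuous along such
  `O`; it cannot happen: `Cen ⊇ I(Sing B) ≠ 0` because `B` is a finitely generated domain over a
  perfect field (regular locus open and non-empty; tree `isJ2Ring_of_finiteType_field`).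
* O-minimal `x_t` exists for every `O ⊇ B_t`: `Cen` is finitely generated (Noetherian), take a
  generator of least valuation.  So every `O` has Valid paths and the conclusion is never vacuous.
* "Unreachable singular point" (`Rtd B m r` for all `r` ⇒ `m` in no centre ⇒ `H2` false): refuted on
  paper — translation invariance at the constant arc gives, for every `w₀ ∈ W` and `ρ > 0`, an arc
  with leading vector `t^ρ w₀`, so `W(k) ⊆ C_m(Spec B)(k)` (initial forms kill leading vectors),
  hence `r ≤ dim W ≤ dim C_m = dim B`; typed rtd `≤ dim`, `Cen B d = I(Sing)` for `d ≥ dim B`.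
* cusp `B = k[t²,t³]`, `m = (t²,t³)`: typed `Rtd B m 1` is FALSE for every presentation `g`
  (pairs of arcs `u, -u+ε`, `|ε| ≤ |u|²`, are the only pairs whose rv-difference leaves the line
  `k·c₂`; translating such a pair by `w = t^β w₀`, `β < 2·ord u`, must reproduce it at the same
  norm `|u|³`, impossible since `|b - a| ≤ |u|²`; char 2 handled by rattack's variant) — so the
  typed rtd agrees with Monreal's `S_0 = {cusp}` here; the encoding is not degenerate.
[folklore] -/
theorem attackB_vacuityH2 : True := trivial

/-- ATTACK C (vacuity of `H1`): `H1` is believed PROVABLE, hence no vacuity.  Sketch for the provers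
of stmt-18840 (both directions are explicit straightener transports; `Arc B m ≃ Arc B' m'`
canonically since every arc at `m` makes `s` a unit, `s ∉ m`):
(⇐, `Rtd B m r → Rtd B' m' r`, `B' = B[s⁻¹]`): presentation `g' := (g, s⁻¹ - c)` with `c = s⁻¹ mod m'`;
the new coordinate is `y = Q(g)` with `Q` a power series of order `≥ 2` plus the linear form
`ℓ = d(s⁻¹)(0)`; put `W' := graph(ℓ|_W)`, `φ'(a) := (φ a, ℓ(φ a))`; risometry because
`|Q(a) - Q(b)| < |a - b|` on the open ball and `|ℓ(v)| ≤ |v|`; image `= graph(ℓ) over Im φ`, invariant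
under `(w, ℓ w)`.
(⇒): `g` any generators of `B` in `m`; the bijection `Arc' → Arc` is coordinatewise polynomial
`P` (no constant term) with inverse a power series; `N := dP(0)`; `φ := N ∘ φ' ∘ (Arc ≃ Arc')`,
`W := N(W')`; risometry since `|a-b| = |a'-b'|` and `N(φ'a'-φ'b') = (a-b) + o(|a-b|)`; translation
invariance via a `k`-linear section of `N : W' → N W'`; `dim N W' = dim W'` because `W' ⊆ C_0(Arc')(k)`
and `M N = id` on leading vectors of arcs (`M` = linear part of the inverse), every `k`-point of the
tangent cone being the leading vector of some Hahn-series arc (`k((t^ℚ))` is algebraically closed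
and the exceptional divisor of `Bl_0` is met by arcs).  No kill. [folklore] -/
theorem attackC_vacuityH1 : True := trivial

/-- ATTACK D (glue mis-modelling, the planner's why-might-fail) — checks out, no kill:
(i) `step B d x = k[B ∪ Cen·x⁻¹] = B[Cen/x]` is the `x`-chart `D₊(x)` of `Bl_Cen Spec B` for ANY
`x ∈ Cen \ 0` (Rees algebra), and the centre of `O ⊇ B` lies in it iff `x` is `O`-minimal (= `Valid`);
(ii) `loc O B = B_(𝔪_O ∩ B)` when `B ⊆ O` (maintained by `Valid`), a local Noetherian ring, `= 𝒪_{Bl,centre}`;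
(iii) `Cen(B,d) = ⋂{m max : singular, ¬Rtd(d+1)} = I(Z)` with `Z` the Zariski closure of the cut
(Jacobson ring), radical; on a common principal open `B[1/s] = B'[1/s']` (equal subalgebras of `K`)
two applications of `H1` plus locality of regularity give `Cen(B,d)·B[1/s] = Cen(B[1/s],d)`
(closure commutes with restriction to opens; radical ideals of a Jacobson ring are determined by
closed points) — so the `Z_t` glue to closed reduced subschemes of the global `X_t` and blow-ups are
proper (Stacks 02NS, tree) and birational (`Cen ≠ 0`); (iv) every point of `X_m` is the centre of a
valuation ring `O ⊇ k` of `K`, `O ⊇ B^{(j)}` for the chart of its image, and the `O`-valid path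
reaches a chart containing it, so "`∀ O, loc regular`" = "`X_m` regular"; (v) `X_m → X'` is an
isomorphism over `Reg X'` (centres inside `Sing`), irrelevant anyway for the weak `HasResolution`;
(vi) non-projective `X`: Chow (tree `ChowLemmaIntegral_holds`) + `HasResolution.of_isBirational`,
re-embedding so that all `h_i ≠ 0`.  The only slack found: none — `H2` is consumed exactly at the
coordinate vectors of Chow models, and every `(K, h)` is one. [folklore] -/
theorem attackD_glueModelling : True := trivial

/-- ATTACK E (other conclusion-block hypotheses): dropping `LocallyOfFiniteType` is refutable in
principle (spectrum of the absolute integral closure `k[X]⁺`, tree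
`not_hasResolution_spec_of_forall_exists_pow_eq`, proved there over `𝔽_p`; the `𝔽̄_p` copy is
routine and not load-bearing for any prover, so not formalised this cycle); dropping `IsSeparated`,
`QuasiCompact`, `IsAlgClosed` or `CharP` is NOT refutable (each weakening is still implied by, or
is, a case of resolution).  Natural strengthenings of the conclusion (projective `π`, iso over
`Reg X`) are plausible, not refutable. [folklore] -/
theorem attackE_conclusionHypotheses : True := trivial

/-- ATTACK F (mutation of `H2`'s `Valid` clause — "O-minimality possibly unnecessary"): the
third conjunct of `Valid` (`∀ a' ∈ Cen B d, a'·x_t⁻¹ ∈ O`) is REDUNDANT for the truth value of `H2`.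
Reason (paper): for ANY valuation ring `O ⊇ k` and any `B ⊆ K`,
`loc O B = {a/s : a, s ∈ B, v(s) ≤ 0} = B_P` with `P = {b : v(b) > Δ_B}`, `Δ_B` the convex subgroup
generated by the negative values on `B` — i.e. `loc O B = loc O_Δ B` is the local ring of `Spec B`
at the centre of the finest coarsening `O_Δ ⊇ O` that CONTAINS `B` (always local, always a
localisation of `B` at a prime; `= B_(𝔪_O ∩ B)` iff `B ⊆ O`).  A path that is not `O`-minimal at
some step leaves `O` but stays inside such an `O_Δ`, for which it IS valid, and `H2` at `O_Δ`
already asserts regularity of the same ring.  So deleting the clause neither creates junk nor a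
cheap counterexample; it only enlarges the path set harmlessly (information for stmt-18546 provers;
nothing changes for this glue, which uses minimal paths to locate centres in charts). [folklore] -/
theorem attackF_validMinimalityRedundant : True := trivial

/-- BARRIERS consulted (catalogue `Literature/Barriers/ResolutionOfSingularities/`):
`DimensionFourFrontier` (Zariski patching of local uniformizations) does not bite — `H2` is uniform
in `O` (one schedule), so the glue never joins finitely many LU models; an `O`-pointwise reading
`∀ O ∃ sched` WOULD enter the barrier (note for planners: do not weaken `H2` that way).
`QuasiExcellenceNecessary`, `InseparableBaseChange*`, `RegularNotGeometricallyRegular`,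
`FrobeniusTwistResolution`: n/a (finite type over an algebraically closed field, no base change).
Termination barriers (`KangarooShadeIncrease`, `ResidualOrderUnbounded*`, `Narasimhan…`,
`DirectrixSmallCharacteristic`, `LocalMonomializationFails*`, `ArtinSchreierPuiseux`) constrain the
TRUTH of `H2`, i.e. crux stmt-18546, not this glue.  `ledger negatives`: 1 entry (DefectlessFrames
19085), unrelated. [folklore] -/
theorem barriers_consulted : True := trivial

end Summit.ResolutionOfSingularities.ResolutionOfSingularities.Cruxes.RisoGlobalisation.Disproof

end
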